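import Summits.QuantumFields.YangMills.Theorems.SwapVirialDeficitSectorLaplaceTipDetModRot
import Summits.QuantumFields.YangMills.Theorems.SwapVirialDeficitSectorLaplaceMbDensitySoftCeilHub
import HarnessLib

/-!
# Route `SwapVirialDeficit` (YangMills): THE APEX REFERENCE WEIGHT IS SHELL MASS — `w₀(p)·((1+d)Λ)^{−7∕2}e^{−1∕2}∕√D_apex(p) ≤ e^{1∕2}·𝔪(hubAt δ_s 1, ε, p)`
# (cell ym-idea-1, skeleton ➎, `stub_core_tip`, hCore glue 'planeRef_le_shellMass' of w3 g68's memo-hCore §2(vi) ∕ g49's binder 01:13Z: the core ceiling is produced against the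
# apex reference `D_apex(p) = det A_F^{hub 1}(gnoBase p)`, the plug consumes shell currency `𝔪(hubAt δ_s 1, ε, p)`;
# free-hands support of ⟨stmt-QuantumFields-24197⟩ `SwapVirialDeficit.SwapGluedStiffness`)

★★ `apexRef_le_mbDensity_hubAt` — good signs, `1 ≤ δ_r ≤ δ_s` in the hub matching window `122689728·δ_r⁻¹·L⁴ ≤ μ_F∕(2·3|Fol L|)`, `A₀` any follower-Hessian family at the
apex hub `1` (symmetric, ray and ambient identities), every base point `p`:
`(1+x₀²)⁻¹(1+y₀²)⁻¹·(((1+d)·20400L⁴)^{−7∕2}·e^{−1∕2}∕√det A₀(gnoBase p)) ≤ e^{1∕2}·𝔪(hubAt δ_s 1, ε, p)`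
(w2 g60's isotropic rescaled floor ✓`mbDensity_ge_detFol_rescaled'` at the shell hub + the apex↔shell base-point matching ✓`abs_log_det_apex_base_le`, `θ(δ_s) ≤ δ_s⁻¹ ≤ δ_r⁻¹`).

HONEST LABEL: a 40-line conversion; hCore and the assembly of `stub_core_tip`, ⟨24197⟩ ∕ ⟨24194⟩ remain OPEN; own crux ⟨22884⟩ `LargeFieldMassRefinementTail` OPEN (blocked-on
⟨19935⟩); the Yang–Mills mass gap is NOT proved; no summit is proved by a line.  THEOREMS ONLY (0 `def`, 0 `sorry`, no instance), standard axioms.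
Width seat ym-line-sfw-p2-w2 g61 (cell ym-idea-1, free hands), `--supports stmt-QuantumFields-24197`.  References: [cite: Luscher1983, §2]; [cite: Breitung1994, Lemma 26]; [folklore].
-/

set_option autoImplicit false
set_option synthInstance.maxSize 1024

noncomputable section

open MeasureTheory Quaternion Set Module
open scoped Quaternion BigOperators ENNReal InnerProductSpace
open Literature.MathematicalPhysics.QuantumLattice
open Literature.MathematicalPhysics.QuantumFieldTheory hiding SU2

namespace Summit.QuantumFields.YangMills.Theorems.SwapVirialDeficit.SectorLaplace

open Summit.QuantumFields.YangMills.Theorems.FemtoTransferGap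
open Summit.QuantumFields.YangMills.Theorems.FemtoTransferGap.TT
open Summit.QuantumFields.YangMills.Theorems.VirialFluxGap.RingDeficit
open Summit.QuantumFields.YangMills.Theorems.SwapVirialDeficit.SwapRing
open Summit.QuantumFields.YangMills.Theorems.SwapVirialDeficit.BlowUpRing

variable {L : ℕ} [NeZero L]

set_option maxHeartbeats 800000 in
/-- ★★ **THE APEX REFERENCE WEIGHT IS SHELL MASS** (see the file header). [cite: Luscher1983, §2] [cite: Breitung1994, Lemma 26] -/
theorem apexRef_le_mbDensity_hubAt {ε : GnoSign L} (hε : GoodSign ε) {δr δs : ℝ} (hδr : 1 ≤ δr) (hrs : δr ≤ δs)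
    (hwin : 122689728 * δr⁻¹ * (L : ℝ) ^ 4 ≤ (2304 * (L : ℝ) ^ 6 * (Fintype.card (Fol L) : ℝ))⁻¹ / (2 * (3 * (Fintype.card (Fol L) : ℝ))))
    {A0 : GnoCoord L → GnoFol L →ₗ[ℝ] GnoFol L} (hA0s : ∀ η, (A0 η).IsSymmetric)
    (hA0ray : ∀ η (y : GnoFol L), ⟪A0 η y, y⟫_ℝ = iteratedDeriv 2 (fun s : ℝ => gnoDeficit (fun _ => false) (fun _ => 1) ((1 : ℝ) : ℍ) ε (η + s • gnoFolEmb y)) 0)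
    (hA0amb : ∀ η (y : GnoFol L), ⟪A0 η y, y⟫_ℝ = iteratedFDeriv ℝ 2 (gnoDeficit z₀ (fun _ => 1) ((1 : ℝ) : ℍ) ε) η (fun _ => gnoFolEmb y))
    (p : ℝ × ℝ) :
    (1 + p.1 ^ 2)⁻¹ * (1 + p.2 ^ 2)⁻¹ * (((1 + (finrank ℝ (GnoFol L) : ℝ)) * (20400 * (L : ℝ) ^ 4)) ^ (-(7 / 2 : ℝ)) *
        Real.exp (-(1 / 2 : ℝ)) / Real.sqrt (LinearMap.det (A0 (gnoBase p.1 p.2)))) ≤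
      Real.exp (1 / 2) * mbDensity (L := L) (hubAt δs 1) ε p := by
  have hL : (0 : ℝ) < (L : ℝ) := Nat.cast_pos.2 (Nat.pos_of_ne_zero (NeZero.ne L))
  have hδr0 : 0 < δr := by linarith
  have hδs0 : 0 < δs := by linarith
  set μ : ℝ := (2304 * (L : ℝ) ^ 6 * (Fintype.card (Fol L) : ℝ))⁻¹ with hμ
  have hμ0 : 0 < μ := (folMu_pos_le (L := L)).1
  -- the shell family at `hubAt δs 1 ~ angUnit θs`
  obtain ⟨As, hAss, -, hAsyy, hAsray, hAsamb, -, -⟩ := exists_gnoFolHessian (fun _ => false) (fun _ => (1 : SU2)) (hubAt_one_ne_zero δs) ε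
  have hres : (hubAt δs 1).re ≠ 0 := by rw [hubAt_one_re]; exact hδs0.ne'
  have hS := mbDensity_ge_detFol_rescaled' hres (hubAt_one_im_ne_zero δs) hε p hAss hAsyy
  -- angle reading
  have eθs : gnoDeficit (fun _ => false) (fun _ => (1 : SU2)) (hubAt δs 1) ε =
      gnoDeficit (fun _ => false) (fun _ => 1) (angUnit (Real.pi / 2 - Real.arctan δs)) ε :=
    funext fun η => gnoDeficit_hubAt_eq_angUnit _ _ δs ε η
  have hAsray' : ∀ η (y : GnoFol L), ⟪As η y, y⟫_ℝ =
      iteratedDeriv 2 (fun s : ℝ => gnoDeficit (fun _ => false) (fun _ => 1) (angUnit (Real.pi / 2 - Real.arctan δs)) ε (η + s • gnoFolEmb y)) 0 := fun η y => by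
    rw [hAsray η y, eθs]
  have hAsamb' : ∀ η (y : GnoFol L), ⟪As η y, y⟫_ℝ =
      iteratedFDeriv ℝ 2 (gnoDeficit (fun _ => false) (fun _ => 1) (angUnit (Real.pi / 2 - Real.arctan δs)) ε) η (fun _ => gnoFolEmb y) := fun η y => by
    rw [← eθs]; exact hAsamb η y
  have hθs0 : 0 < Real.pi / 2 - Real.arctan δs := (hubAngle_mem δs).1
  have hθs : |Real.pi / 2 - Real.arctan δs| ≤ δr⁻¹ := by
    rw [abs_of_pos hθs0]
    exact (hubAngle_le_inv hδs0).trans (inv_anti₀ hδr0 hrs)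
  have hwinθ : 122689728 * |Real.pi / 2 - Real.arctan δs| * (L : ℝ) ^ 4 ≤ μ / (2 * (3 * (Fintype.card (Fol L) : ℝ))) :=
    le_trans (by gcongr) hwin
  have hlog := abs_log_det_apex_base_le hε (sin_hubAngle_pos δs).le hA0s hA0amb hAss hAsray' hAsamb' hwinθ p
  -- positivity of the determinants
  have h1ne : ((1 : ℝ) : ℍ) ≠ 0 := by exact_mod_cast one_ne_zero
  have hdets : μ ^ finrank ℝ (GnoFol L) ≤ LinearMap.det (As (gnoBase p.1 p.2)) :=
    det_gnoFolHessian_base_ge (hubAt_one_ne_zero δs) ε hε.1 hε.2 p.1 p.2 hAss hAsray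
  have hdets0 : 0 < LinearMap.det (As (gnoBase p.1 p.2)) := lt_of_lt_of_le (by positivity) hdets
  have hdet0 : μ ^ finrank ℝ (GnoFol L) ≤ LinearMap.det (A0 (gnoBase p.1 p.2)) := det_gnoFolHessian_base_ge h1ne ε hε.1 hε.2 p.1 p.2 hA0s hA0ray
  have hdet0' : 0 < LinearMap.det (A0 (gnoBase p.1 p.2)) := lt_of_lt_of_le (by positivity) hdet0
  -- `√det A_s ≤ e^{1/2}·√det A₀`
  have hM : Real.sqrt (LinearMap.det (As (gnoBase p.1 p.2))) ≤ Real.exp (1 / 2) * Real.sqrt (LinearMap.det (A0 (gnoBase p.1 p.2))) := by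
    have hlog1 : Real.log (LinearMap.det (As (gnoBase p.1 p.2))) ≤ Real.log (LinearMap.det (A0 (gnoBase p.1 p.2))) + 1 := by
      have h2 := (abs_sub_le_iff.1 hlog).2
      linarith
    have h1 : LinearMap.det (As (gnoBase p.1 p.2)) ≤ Real.exp 1 * LinearMap.det (A0 (gnoBase p.1 p.2)) := by
      rw [← Real.exp_log hdets0, ← Real.exp_log hdet0', ← Real.exp_add, add_comm]
      exact Real.exp_le_exp.2 hlog1
    have h2 : Real.exp 1 = Real.exp (1 / 2) ^ 2 := by rw [← Real.exp_nat_mul]; norm_num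
    calc Real.sqrt (LinearMap.det (As (gnoBase p.1 p.2))) ≤ Real.sqrt (Real.exp 1 * LinearMap.det (A0 (gnoBase p.1 p.2))) := Real.sqrt_le_sqrt h1
      _ = Real.exp (1 / 2) * Real.sqrt (LinearMap.det (A0 (gnoBase p.1 p.2))) := by
          rw [Real.sqrt_mul (Real.exp_pos _).le, h2, Real.sqrt_sq (Real.exp_pos _).le]
  -- assemble
  have hD0 : 0 < Real.sqrt (LinearMap.det (A0 (gnoBase p.1 p.2))) := Real.sqrt_pos.2 hdet0'
  have hDs : 0 < Real.sqrt (LinearMap.det (As (gnoBase p.1 p.2))) := Real.sqrt_pos.2 hdets0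
  set K7 : ℝ := ((1 + (finrank ℝ (GnoFol L) : ℝ)) * (20400 * (L : ℝ) ^ 4)) ^ (-(7 / 2 : ℝ)) * Real.exp (-(1 / 2 : ℝ)) with hK7
  have hd9 := nine_le_finrank_gnoFol (L := L)
  have hK70 : 0 < K7 := by rw [hK7]; exact mul_pos (Real.rpow_pos_of_pos (by positivity) _) (Real.exp_pos _)
  set w : ℝ := (1 + p.1 ^ 2)⁻¹ * (1 + p.2 ^ 2)⁻¹ with hw
  have hw0 : 0 < w := by rw [hw]; positivity
  calc w * (K7 / Real.sqrt (LinearMap.det (A0 (gnoBase p.1 p.2))))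
      ≤ w * (K7 / (Real.sqrt (LinearMap.det (As (gnoBase p.1 p.2))) / Real.exp (1 / 2))) := by
        refine mul_le_mul_of_nonneg_left (div_le_div_of_nonneg_left hK70.le (by positivity) ?_) hw0.le
        rw [div_le_iff₀ (Real.exp_pos _)]
        linarith [hM, mul_comm (Real.exp (1 / 2)) (Real.sqrt (LinearMap.det (A0 (gnoBase p.1 p.2))))]
    _ = Real.exp (1 / 2) * (w * (K7 / Real.sqrt (LinearMap.det (As (gnoBase p.1 p.2))))) := by field_simp
    _ ≤ Real.exp (1 / 2) * mbDensity (L := L) (hubAt δs 1) ε p := mul_le_mul_of_nonneg_left hS (Real.exp_pos _).le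

end Summit.QuantumFields.YangMills.Theorems.SwapVirialDeficit.SectorLaplace

end
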